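import Literature.MathematicalPhysics.QuantumLattice.DWaveSourceThermalStatesDKMS
import Literature.MathematicalPhysics.QuantumLattice.TorusGibbsBogoliubovRow
import HarnessLib

/-!
# Thermal states of the PAIR-SOURCED 2D `t–t'` Hubbard torus satisfy the Bogoliubov rows for EVERY pair of local words

Family `hubbard` (topic `MathematicalPhysics/QuantumLattice`). The pair-sourced twin of
`HubbardTTPrimeGrandCanonicalThermalStatesBogoliubovRows` (the same rows for the UNSOURCED grand-canonical Gibbs states) and the
Bogoliubov-row companion of `DWaveSourceThermalStatesDKMS` (stationarity + energy–entropy balance rows of the same states, which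
make them dKMS states of the sourced interaction). The states are Koma–Tasaki's symmetry-breaking thermal states BEFORE the
source is switched off [cite: KomaTasaki1993, §1 (1.8)]: torus limits `ω` of the grand-canonical Gibbs states
`e^{−βA_L}/tr e^{−βA_L}` of the pair-sourced torus Hamiltonian

  `A_L(h) = dWaveSourceTorusTT' L t' U μ h = H_L(1,t',U) − μN − h(Δ_d + Δ_d†)`

(eigen-mixtures `(sourcedGibbsCount, sourcedGibbsWeightTT' β t' U μ h, sourcedGibbsVectorTT' t' U μ h)`). For such an `ω` at
`β ≥ 0`, every `Λ ⊆ Λ'` with `thicken Λ 1 ⊆ Λ'` and ALL local words `A, C ∈ 𝔄_Λ` (charged or not — the source itself breaks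
`U(1)`; `Ã, C̃` their embeddings in `𝔄_{Λ'}`, `H_{Λ'} = pairSourceWindowHamiltonianTT' d Λ' t' U μ h = H^{tt'}_{Λ'} − μN_{Λ'} −
h(S_{Λ'} + S_{Λ'}ᴴ)`, the local Hamiltonian of the sourced interaction `hubbardTTPrimeSourcedInteraction 1 t' U μ d h`):

  `0 ≤ Re ω_{Λ'}( ÃÃᴴ + ÃᴴÃ + 2·(C̃Ã − ÃC̃) + (β/2)·(C̃ᴴ(H_{Λ'}C̃ − C̃H_{Λ'}) − (H_{Λ'}C̃ − C̃H_{Λ'})C̃ᴴ) )`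

(`IsTorusLimitOfMixture.re_expect_bog_nonneg_of_sourcedGibbs`) — the linear form of Bogoliubov's inequality
`|ω([C̃, Ã])|² ≤ ½β ω({Ã, Ãᴴ}) ω([C̃ᴴ, [H, C̃]])` [cite: DLS1978, §2 eq. (28)] for the SOURCED dynamics. Ingredients: the generic
sector lemma `sum_canonicalWeight_mul_re_expect_bog_mulVec_nonneg` on the trivial sector (§1: every `B, C`, every translate), the
torus locality `[A_L, ΓC̃] = Γ[H_{Λ'}, C̃]` (`dWaveSourceTorusTT'_commutator_fermionEmbed`), the translation average (§2) and the
limit (§3). These rows are the input of the Mermin–Wagner argument for Koma–Tasaki's infinitesimal-field thermal states (they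
pass to the limit `h ↓ 0`, being affine in `h`). Everything is PROVED; no definition, no named fact, no sorry.
WHAT THIS IS NOT: a statement about `h = 0` after `L → ∞` (that is the sequel), nor any claim of order.

## Mathlib / tree search

`lean search 'bog.*sourcedGibbs|sourcedGibbs.*bog'` (2026-08-29): nothing; the unsourced rows are
`IsTorusLimitOfMixture.re_expect_bog_nonneg_of_gcGibbs` (`HubbardTTPrimeGrandCanonicalThermalStatesBogoliubovRows`, followed here
line by line). REUSED: `sum_canonicalWeight_mul_re_expect_bog_mulVec_nonneg` (`TorusGibbsBogoliubovRow`),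
`fockTranslate_val_conjTranspose_mul_val_mul`, `fockTranslate_val_mul_val_conjTranspose_mul` (`TorusGibbsEnergyEntropyBalance`),
`fockTranslate_commute_dWaveSourceTorusTT'` (`DWaveSourceThermalStatesDKMS`), `dWaveSourceTorusTT'_isHermitian`,
`dWaveSourceTorusTT'_commutator_fermionEmbed` (`DWaveSourceNNNHoppingWindowHamiltonian`), `sourcedGibbs{Energy,Vector}TT'_eq`,
`sourcedGibbsIndex`, `canonicalWeight_comp_equiv'`, `torusAvgExpectAt_of_injOn`, `torusAvgExpect_eq`, `eventually_injOn_proj_of_tendsto`,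
`pairSourceWindowHamiltonianTT'_dWave_eq_localHamiltonian`.

## References

* F. J. Dyson, E. H. Lieb, B. Simon, *Phase transitions in quantum spin systems with isotropic and nonisotropic interactions*,
  J. Stat. Phys. 18 (1978) 335–383, §2 eq. (28) (Bogoliubov's inequality). [cite: DLS1978, §2 eq. (28)]
* T. Koma, H. Tasaki, *Symmetry breaking in Heisenberg antiferromagnets*, Commun. Math. Phys. 158 (1993) 191–214, §1 (1.8)
  (thermal states under a symmetry-breaking field). [cite: KomaTasaki1993, §1 (1.8)]
* H. Fawzi, O. Fawzi, S. O. Scalet, Nat. Commun. 15 (2024) 7394, Thm. 3.1, §3.2 (KMS constraints linear in the state).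
  [cite: FawziFawziScalet2024, Thm. 3.1]
-/

noncomputable section

namespace Literature.MathematicalPhysics.QuantumLattice

open Matrix Finset HubbardWave0 Literature.Probability.LatticeModels ThermodynamicLimit
open _root_.Filter
open scoped _root_.Topology ComplexOrder BigOperators

/-! ### §1 Finite volume: the Bogoliubov row in the translated eigen-mixtures of the pair-sourced torus, every `B, C` -/

section FiniteVolume

variable (L : ℕ) [NeZero L] {β : ℝ} (hβ : 0 ≤ β) (tp U μ h : ℝ)
include hβ

/-- **The Bogoliubov row for the translated Gibbs mixtures of the pair-sourced torus, EVERY pair of torus operators `B, C`**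
(`β ≥ 0`; no conservation law — the mixture lives on the whole Fock space and the source breaks `U(1)`): for a translation `v`,
`0 ≤ Σ_i p_{L,i} Re⟨U_vψ_{L,i}, (BBᴴ + BᴴB + 2·(CB − BC) + (β/2)·(Cᴴ(A_L C − C A_L) − (A_L C − C A_L)Cᴴ)) U_vψ_{L,i}⟩`.
[cite: DLS1978, §2 eq. (28)] -/
theorem sum_sourcedGibbsWeightTT'_mul_re_expect_bog_fockTranslate_nonneg (v : TorusSite 2 L)
    (B C : Matrix (Finset (Orb (FermionTorus 2 L))) (Finset (Orb (FermionTorus 2 L))) ℂ) :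
    0 ≤ ∑ i, sourcedGibbsWeightTT' β tp U μ h L i *
      (star ((fockTranslate v).val *ᵥ sourcedGibbsVectorTT' tp U μ h L i) ⬝ᵥ
        ((B * Bᴴ + Bᴴ * B + ((2 : ℝ) : ℂ) • (C * B - B * C) +
            ((β / 2 : ℝ) : ℂ) • (Cᴴ * (dWaveSourceTorusTT' L tp U μ h * C - C * dWaveSourceTorusTT' L tp U μ h) -
              (dWaveSourceTorusTT' L tp U μ h * C - C * dWaveSourceTorusTT' L tp U μ h) * Cᴴ)) *ᵥ
          ((fockTranslate v).val *ᵥ sourcedGibbsVectorTT' tp U μ h L i))).re := by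
  set K := dWaveSourceTorusTT' L tp U μ h with hKdef
  have hK : K.IsHermitian := dWaveSourceTorusTT'_isHermitian L tp U μ h
  have hvac : ∀ (X : Matrix (Finset (Orb (FermionTorus 2 L))) (Finset (Orb (FermionTorus 2 L))) ℂ)
      (i j : Finset (Orb (FermionTorus 2 L))), ¬ (fun _ => True) i → (fun _ => True) j → X i j = 0 :=
    fun _ _ _ hi _ => (hi trivial).elim
  have key := sum_canonicalWeight_mul_re_expect_bog_mulVec_nonneg (fun _ => True) hK (hvac K)
    (fockTranslate_val_conjTranspose_mul_val_mul L v) (fockTranslate_val_mul_val_conjTranspose_mul L v)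
    (fockTranslate_commute_dWaveSourceTorusTT' L tp U μ h v) (hvac _) (hvac _) (hvac B) (hvac Bᴴ)
    (hvac C) (hvac Cᴴ) hβ
  set e := sourcedGibbsIndex L with he
  refine key.trans_eq ?_
  rw [← Equiv.sum_comp e]
  refine Finset.sum_congr rfl fun i _ => ?_
  rw [sourcedGibbsWeightTT', show sourcedGibbsEnergyTT' tp U μ h L = sectorEigenvalue (fun _ => True) K hK ∘ e from
    funext fun i => sourcedGibbsEnergyTT'_eq tp U μ h L i, canonicalWeight_comp_equiv', sourcedGibbsVectorTT'_eq]

end FiniteVolume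

/-! ### §2 Translation averages of the embedded Bogoliubov rows -/

section TorusAverage

variable (L : ℕ) [NeZero L] {β : ℝ} (hβ : 0 ≤ β) (tp U μ h : ℝ)
include hβ

/-- **The Bogoliubov row of ANY two local words, averaged over the torus translations, is nonnegative in the Gibbs mixture of
the pair-sourced torus** (`β ≥ 0`). For `Λ ⊆ Λ'` with `thicken Λ 1 ⊆ Λ'`, `x ↦ x mod L` injective on `thicken Λ' 1`, `A, C ∈ 𝔄_Λ`,
`Ã = Γ_{Λ⊆Λ'}A`, `C̃ = Γ_{Λ⊆Λ'}C`, `H_{Λ'} = pairSourceWindowHamiltonianTT' d Λ' t' U μ h`: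
`0 ≤ Re Σ_i p_{L,i} · torusAvgExpectAt L Λ' (ÃÃᴴ + ÃᴴÃ + 2·(C̃Ã − ÃC̃) + (β/2)·(C̃ᴴ[H_{Λ'},C̃] − [H_{Λ'},C̃]C̃ᴴ)) ψ_{L,i}`
(torus locality `[A_L, ΓC̃] = Γ[H_{Λ'}, C̃]`). [cite: DLS1978, §2 eq. (28)] -/
theorem re_sum_sourcedGibbsWeightTT'_mul_torusAvgExpectAt_bog_nonneg {Λ Λ' : Finset (Site 2)} (hΛ : Λ ⊆ Λ')
    (h8 : thicken Λ 1 ⊆ Λ') (hInj : Set.InjOn (Torus.proj (d := 2) L) ↑(thicken Λ' 1)) (A C : FermionOp Λ) :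
    0 ≤ (∑ i, (sourcedGibbsWeightTT' β tp U μ h L i : ℂ) *
      torusAvgExpectAt L Λ'
        (fermionEmbed (PolySite.incl hΛ) A * (fermionEmbed (PolySite.incl hΛ) A)ᴴ +
          (fermionEmbed (PolySite.incl hΛ) A)ᴴ * fermionEmbed (PolySite.incl hΛ) A +
          ((2 : ℝ) : ℂ) • (fermionEmbed (PolySite.incl hΛ) C * fermionEmbed (PolySite.incl hΛ) A -
            fermionEmbed (PolySite.incl hΛ) A * fermionEmbed (PolySite.incl hΛ) C) +
          ((β / 2 : ℝ) : ℂ) • ((fermionEmbed (PolySite.incl hΛ) C)ᴴ *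
              (pairSourceWindowHamiltonianTT' dWaveFormFactor Λ' tp U μ h * fermionEmbed (PolySite.incl hΛ) C -
                fermionEmbed (PolySite.incl hΛ) C * pairSourceWindowHamiltonianTT' dWaveFormFactor Λ' tp U μ h) -
            (pairSourceWindowHamiltonianTT' dWaveFormFactor Λ' tp U μ h * fermionEmbed (PolySite.incl hΛ) C -
                fermionEmbed (PolySite.incl hΛ) C * pairSourceWindowHamiltonianTT' dWaveFormFactor Λ' tp U μ h) *
              (fermionEmbed (PolySite.incl hΛ) C)ᴴ))
        (sourcedGibbsVectorTT' tp U μ h L i)).re := by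
  have h₁ : Set.InjOn (Torus.proj (d := 2) L) ↑Λ' := hInj.mono (by exact_mod_cast subset_thicken Λ' 1)
  set K := dWaveSourceTorusTT' L tp U μ h with hKdef
  set B := fermionEmbed (PolySite.toTorusEmb L h₁) (fermionEmbed (PolySite.incl hΛ) A) with hBdef
  set D := fermionEmbed (PolySite.toTorusEmb L h₁) (fermionEmbed (PolySite.incl hΛ) C) with hDdef
  -- the local commutator pulls back to the torus commutator
  have hKC : fermionEmbed (PolySite.toTorusEmb L h₁)
      (pairSourceWindowHamiltonianTT' dWaveFormFactor Λ' tp U μ h * fermionEmbed (PolySite.incl hΛ) C -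
        fermionEmbed (PolySite.incl hΛ) C * pairSourceWindowHamiltonianTT' dWaveFormFactor Λ' tp U μ h) = K * D - D * K := by
    rw [← dWaveSourceTorusTT'_commutator_fermionEmbed L hΛ h8 hInj tp U μ h C]
  -- pull the row back into the torus
  have hΓ : fermionEmbed (PolySite.toTorusEmb L h₁)
      (fermionEmbed (PolySite.incl hΛ) A * (fermionEmbed (PolySite.incl hΛ) A)ᴴ +
          (fermionEmbed (PolySite.incl hΛ) A)ᴴ * fermionEmbed (PolySite.incl hΛ) A +
          ((2 : ℝ) : ℂ) • (fermionEmbed (PolySite.incl hΛ) C * fermionEmbed (PolySite.incl hΛ) A -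
            fermionEmbed (PolySite.incl hΛ) A * fermionEmbed (PolySite.incl hΛ) C) +
          ((β / 2 : ℝ) : ℂ) • ((fermionEmbed (PolySite.incl hΛ) C)ᴴ *
              (pairSourceWindowHamiltonianTT' dWaveFormFactor Λ' tp U μ h * fermionEmbed (PolySite.incl hΛ) C -
                fermionEmbed (PolySite.incl hΛ) C * pairSourceWindowHamiltonianTT' dWaveFormFactor Λ' tp U μ h) -
            (pairSourceWindowHamiltonianTT' dWaveFormFactor Λ' tp U μ h * fermionEmbed (PolySite.incl hΛ) C -
                fermionEmbed (PolySite.incl hΛ) C * pairSourceWindowHamiltonianTT' dWaveFormFactor Λ' tp U μ h) *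
              (fermionEmbed (PolySite.incl hΛ) C)ᴴ)) =
      B * Bᴴ + Bᴴ * B + ((2 : ℝ) : ℂ) • (D * B - B * D) +
        ((β / 2 : ℝ) : ℂ) • (Dᴴ * (K * D - D * K) - (K * D - D * K) * Dᴴ) := by
    rw [fermionEmbed_add, fermionEmbed_add, fermionEmbed_add, fermionEmbed_smul, fermionEmbed_smul, fermionEmbed_sub,
      fermionEmbed_sub, fermionEmbed_mul, fermionEmbed_mul, fermionEmbed_mul, fermionEmbed_mul, fermionEmbed_mul,
      fermionEmbed_mul, fermionEmbed_conjTranspose, fermionEmbed_conjTranspose, hKC]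
  -- each translate is nonnegative
  have hv : ∀ v : TorusSite 2 L, 0 ≤ ∑ i, sourcedGibbsWeightTT' β tp U μ h L i *
      (expect (B * Bᴴ + Bᴴ * B + ((2 : ℝ) : ℂ) • (D * B - B * D) +
          ((β / 2 : ℝ) : ℂ) • (Dᴴ * (K * D - D * K) - (K * D - D * K) * Dᴴ))
        ((fockTranslate v).val *ᵥ sourcedGibbsVectorTT' tp U μ h L i)).re := fun v =>
    sum_sourcedGibbsWeightTT'_mul_re_expect_bog_fockTranslate_nonneg L hβ tp U μ h v B D
  have hcast : ((Fintype.card (TorusSite 2 L) : ℂ))⁻¹ = (((Fintype.card (TorusSite 2 L) : ℝ)⁻¹ : ℝ) : ℂ) := by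
    push_cast; rfl
  simp_rw [torusAvgExpectAt_of_injOn L h₁, hΓ]
  rw [Complex.re_sum]
  simp_rw [hcast, ← mul_assoc, ← Complex.ofReal_mul, Complex.re_ofReal_mul, Complex.re_sum, Finset.mul_sum]
  rw [Finset.sum_comm]
  refine Finset.sum_nonneg fun v _ => ?_
  have hfac : ∑ i, sourcedGibbsWeightTT' β tp U μ h L i * (Fintype.card (TorusSite 2 L) : ℝ)⁻¹ *
      (expect (B * Bᴴ + Bᴴ * B + ((2 : ℝ) : ℂ) • (D * B - B * D) +
          ((β / 2 : ℝ) : ℂ) • (Dᴴ * (K * D - D * K) - (K * D - D * K) * Dᴴ))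
        ((fockTranslate v).val *ᵥ sourcedGibbsVectorTT' tp U μ h L i)).re =
      (Fintype.card (TorusSite 2 L) : ℝ)⁻¹ * ∑ i, sourcedGibbsWeightTT' β tp U μ h L i *
      (expect (B * Bᴴ + Bᴴ * B + ((2 : ℝ) : ℂ) • (D * B - B * D) +
          ((β / 2 : ℝ) : ℂ) • (Dᴴ * (K * D - D * K) - (K * D - D * K) * Dᴴ))
        ((fockTranslate v).val *ᵥ sourcedGibbsVectorTT' tp U μ h L i)).re := by
    rw [Finset.mul_sum]
    exact Finset.sum_congr rfl fun i _ => by ring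
  rw [hfac]
  exact mul_nonneg (inv_nonneg.2 (Nat.cast_nonneg _)) (hv v)

end TorusAverage

/-! ### §3 The Bogoliubov rows of the thermal states of the pair-sourced torus, every pair of local words -/

namespace InfVolFermionState

variable {β : ℝ} (hβ : 0 ≤ β) (tp U μ h : ℝ) {ω : InfVolFermionState 2} {Ls : ℕ → ℕ}
include hβ

/-- **Bogoliubov rows of the thermal states of the pair-sourced `t–t'` Hubbard torus, for EVERY pair of local words.** Let
`ω` be a torus limit of the grand-canonical Gibbs states of `A_{Ls j}(h) = dWaveSourceTorusTT' (Ls j) t' U μ h` at inverse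
temperature `β ≥ 0` along `Ls → ∞`. Then for `Λ ⊆ Λ'` with `thicken Λ 1 ⊆ Λ'`, all `A, C ∈ 𝔄_Λ` (`Ã = Γ_{Λ⊆Λ'}A`,
`C̃ = Γ_{Λ⊆Λ'}C`) and `H_{Λ'} = H^{tt'}_{Λ'} − μN_{Λ'} − h(S_{Λ'} + S_{Λ'}ᴴ)`:

  `0 ≤ Re ω_{Λ'}( ÃÃᴴ + ÃᴴÃ + 2·(C̃Ã − ÃC̃) + (β/2)·(C̃ᴴ(H_{Λ'}C̃ − C̃H_{Λ'}) − (H_{Λ'}C̃ − C̃H_{Λ'})C̃ᴴ) )`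

— the linear form of Bogoliubov's inequality of a `β`-KMS state for the SOURCED dynamics.
[cite: DLS1978, §2 eq. (28)] [cite: FawziFawziScalet2024, Thm. 3.1] [cite: KomaTasaki1993, §1 (1.8)] -/
theorem IsTorusLimitOfMixture.re_expect_bog_nonneg_of_sourcedGibbs
    (hω : ω.IsTorusLimitOfMixture sourcedGibbsCount (sourcedGibbsWeightTT' β tp U μ h)
      (sourcedGibbsVectorTT' tp U μ h) Ls)
    (hLs : Tendsto Ls atTop atTop) {Λ Λ' : Finset (Site 2)} (hΛ : Λ ⊆ Λ') (h8 : thicken Λ 1 ⊆ Λ')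
    (A C : FermionOp Λ) :
    0 ≤ (ω.expect Λ'
      (fermionEmbed (PolySite.incl hΛ) A * (fermionEmbed (PolySite.incl hΛ) A)ᴴ +
          (fermionEmbed (PolySite.incl hΛ) A)ᴴ * fermionEmbed (PolySite.incl hΛ) A +
          ((2 : ℝ) : ℂ) • (fermionEmbed (PolySite.incl hΛ) C * fermionEmbed (PolySite.incl hΛ) A -
            fermionEmbed (PolySite.incl hΛ) A * fermionEmbed (PolySite.incl hΛ) C) +
          ((β / 2 : ℝ) : ℂ) • ((fermionEmbed (PolySite.incl hΛ) C)ᴴ *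
              (pairSourceWindowHamiltonianTT' dWaveFormFactor Λ' tp U μ h * fermionEmbed (PolySite.incl hΛ) C -
                fermionEmbed (PolySite.incl hΛ) C * pairSourceWindowHamiltonianTT' dWaveFormFactor Λ' tp U μ h) -
            (pairSourceWindowHamiltonianTT' dWaveFormFactor Λ' tp U μ h * fermionEmbed (PolySite.incl hΛ) C -
                fermionEmbed (PolySite.incl hΛ) C * pairSourceWindowHamiltonianTT' dWaveFormFactor Λ' tp U μ h) *
              (fermionEmbed (PolySite.incl hΛ) C)ᴴ))).re := by
  refine ge_of_tendsto ((Complex.continuous_re.tendsto _).comp (hω Λ' _)) ?_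
  filter_upwards [eventually_injOn_proj_of_tendsto (thicken Λ' 1) hLs, hLs.eventually_ge_atTop 1]
    with j hInj hj
  haveI : NeZero (Ls j) := ⟨by omega⟩
  rw [Function.comp_apply]
  simp_rw [torusAvgExpect_eq]
  exact re_sum_sourcedGibbsWeightTT'_mul_torusAvgExpectAt_bog_nonneg (Ls j) hβ tp U μ h hΛ h8 hInj A C

/-- **The same rows with the window Hamiltonian written as the local Hamiltonian of the sourced interaction**
`hubbardTTPrimeSourcedInteraction 1 t' U μ d h = Φ(1,t',U) − μn − hP_d` (`pairSourceWindowHamiltonianTT'_dWave_eq_localHamiltonian`),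
in the three-term form `0 ≤ Re ω(ÃÃᴴ + ÃᴴÃ) + 2 Re ω(C̃Ã − ÃC̃) + ½β Re ω(C̃ᴴ[H_{Λ'},C̃] − [H_{Λ'},C̃]C̃ᴴ)`.
[cite: DLS1978, §2 eq. (28)] [cite: KomaTasaki1993, §1 (1.8)] -/
theorem IsTorusLimitOfMixture.bogoliubovRow_nonneg_of_sourcedGibbs
    (hω : ω.IsTorusLimitOfMixture sourcedGibbsCount (sourcedGibbsWeightTT' β tp U μ h)
      (sourcedGibbsVectorTT' tp U μ h) Ls)
    (hLs : Tendsto Ls atTop atTop) {Λ Λ' : Finset (Site 2)} (hΛ : Λ ⊆ Λ') (h8 : thicken Λ 1 ⊆ Λ')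
    (A C : FermionOp Λ) :
    0 ≤ (ω.expect Λ' (fermionEmbed (PolySite.incl hΛ) A * (fermionEmbed (PolySite.incl hΛ) A)ᴴ +
          (fermionEmbed (PolySite.incl hΛ) A)ᴴ * fermionEmbed (PolySite.incl hΛ) A)).re +
      2 * (ω.expect Λ' (fermionEmbed (PolySite.incl hΛ) C * fermionEmbed (PolySite.incl hΛ) A -
          fermionEmbed (PolySite.incl hΛ) A * fermionEmbed (PolySite.incl hΛ) C)).re +
      β / 2 * (ω.expect Λ' ((fermionEmbed (PolySite.incl hΛ) C)ᴴ *
            ((hubbardTTPrimeSourcedInteraction 1 tp U μ dWaveFormFactor h).localHamiltonian Λ' *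
                fermionEmbed (PolySite.incl hΛ) C -
              fermionEmbed (PolySite.incl hΛ) C *
                (hubbardTTPrimeSourcedInteraction 1 tp U μ dWaveFormFactor h).localHamiltonian Λ') -
          ((hubbardTTPrimeSourcedInteraction 1 tp U μ dWaveFormFactor h).localHamiltonian Λ' *
                fermionEmbed (PolySite.incl hΛ) C -
              fermionEmbed (PolySite.incl hΛ) C *
                (hubbardTTPrimeSourcedInteraction 1 tp U μ dWaveFormFactor h).localHamiltonian Λ') *
            (fermionEmbed (PolySite.incl hΛ) C)ᴴ)).re := by
  have h0 := hω.re_expect_bog_nonneg_of_sourcedGibbs hβ tp U μ h hLs hΛ h8 A C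
  rw [pairSourceWindowHamiltonianTT'_dWave_eq_localHamiltonian, map_add, map_add, map_smul, map_smul, Complex.add_re,
    Complex.add_re, smul_eq_mul, smul_eq_mul, Complex.re_ofReal_mul, Complex.re_ofReal_mul] at h0
  exact h0

end InfVolFermionState

end Literature.MathematicalPhysics.QuantumLattice

end
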